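import Summits.PneNP.PneNP.Theorems.BavardGapPgProgram
import Summits.PneNP.PneNP.Theorems.BavardGapPgBridge
import Literature.Computability.Complexity.PRelHierarchy
import Literature.Computability.Complexity.PromiseProofs
import Literature.Computability.Complexity.NondeterministicProofs

/-!
# Route BavardGap — `PgDecisionInNP` (stmt-PneNP-2498)

The pairing-genus decision language is in `NP` BY DEFINITION (`NP = ∃^poly P`): the certificate is the pairing `π` as
its list of images (`≤ 8|x|² + 8` symbols), the verifier the typed program of `BavardGapPgProgram` run on
`(x, decoded list)` (every string decodes to SOME list through `canonListFnC`), whose specification is translated into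
the route's language by the bridges of `BavardGapPgBridge` (letters as bit pairs, permutations as lists, cycles as
orbit minima).
-/

set_option linter.dupNamespace false -- `Summit.PneNP.PneNP.…`: summit = sub-problem name (D-0017 single-conjunct layout)

namespace Summit.PneNP.PneNP.Theorems

open _root_.Computability Polynomial
open Literature.Computability.Complexity Literature.Computability.Complexity.CodeFP
  Literature.Computability.Complexity.Brick

/-- **Reading the letters back off the bits.** For `W` of even length, the letter list
`l_j = ([W[2j]], W[2j+1])` has `l.flatMap (fun a => [[a.1 = 1], a.2]) = W`. [folklore] -/
theorem bavardGap_flatMap_lettersOf (W : List Bool) (heven : W.length % 2 = 0) :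
    ((List.ofFn fun j : Fin (W.length / 2) => ((if W.getD (2 * (j : ℕ)) false then (1 : Fin 2) else 0), W.getD (2 * (j : ℕ) + 1) false)).flatMap
      fun a => [decide (a.1 = 1), a.2]) = W := by
  have hlen : (List.ofFn fun j : Fin (W.length / 2) => ((if W.getD (2 * (j : ℕ)) false then (1 : Fin 2) else 0), W.getD (2 * (j : ℕ) + 1) false)).length =
      W.length / 2 := List.length_ofFn
  have hW2 : W.length = 2 * (W.length / 2) := (Nat.mul_div_cancel' (Nat.dvd_of_mod_eq_zero heven)).symm
  refine List.ext_getElem (by rw [bavardGap_length_flatMap, hlen]; omega) fun idx h1 h2 => ?_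
  have hj : idx / 2 < (List.ofFn fun j : Fin (W.length / 2) => ((if W.getD (2 * (j : ℕ)) false then (1 : Fin 2) else 0), W.getD (2 * (j : ℕ) + 1) false)).length := by
    rw [hlen]; omega
  obtain ⟨ha, hb⟩ := bavardGap_getD_flatMap _ (idx / 2) hj
  rw [List.getElem_ofFn] at ha hb
  dsimp only at ha hb
  rw [← List.getD_eq_getElem _ false h1, ← List.getD_eq_getElem _ false h2]
  rcases Nat.mod_two_eq_zero_or_one idx with hr | hr
  · have e : idx = 2 * (idx / 2) := by omega
    rw [e, ha]
    cases W.getD (2 * (idx / 2)) false <;> simp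
  · have e : idx = 2 * (idx / 2) + 1 := by omega
    rw [e, hb]

/-- **`PgDecisionInNP` (stmt-PneNP-2498)**: the pairing-genus decision language is in `NP`.
[cite: Karp1972, §3 (NP by certificates)] [cite: AroraBarakCC2009, Def. 2.1] -/
theorem bavardGap_pgDecisionInNP_proof : Summit.PneNP.PneNP.Theses.BavardGap.PgDecisionInNP := by
  classical
  obtain ⟨τ, ⟨g, hg, hgspec⟩, hspec⟩ := bavardGap_exists_pgTest
  -- the verifier language and its value
  set V : Language Bool := (g ∘ fanoutFn fstF (CanonCode.canonListFnC 2 canonF ∘ sndF)) ⁻¹' PRelSigma.HeadIs true with hV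
  have hVP : V ∈ Classes.P :=
    preimage_mem_P (PRelSigma.HeadIs_mem_P true) (comp_mem_FP hg (fanoutFn_mem_FP fstF_mem_FP
      (comp_mem_FP (CanonCode.canonListFnC_mem_FP 2 canonF_mem_FP) sndF_mem_FP)))
  have hcan : ∀ c : List Bool,
      encodingNatBool.listBool.decode c = some (NegCNF.decList decodeNat (boolUnpair c).1.length (boolUnpair c).2) ∧
        CanonCode.canonListFnC 2 canonF c =
          encodingNatBool.listBool.encode (NegCNF.decList decodeNat (boolUnpair c).1.length (boolUnpair c).2) :=
    fun c => CanonCode.canonListFnC_eq encodingNatBool decodeNat (fun _ => rfl) canonF_eq_encodeNat_decodeNat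
      (A := 1) (B := 1) (fun u => by have := length_canonF_le u; omega) (by norm_num) c
  have hVsem : ∀ x c : List Bool, boolPair x c ∈ V ↔ τ (x, NegCNF.decList decodeNat (boolUnpair c).1.length (boolUnpair c).2) = true := by
    intro x c
    change (g ∘ fanoutFn fstF (CanonCode.canonListFnC 2 canonF ∘ sndF)) (boolPair x c) ∈ PRelSigma.HeadIs true ↔ _
    simp only [Function.comp_apply, fanoutFn_apply, fstF_boolPair, sndF_boolPair, PRelSigma.mem_HeadIs]
    rw [(hcan c).2, listE_eq, show boolPair x (listE encodingNatBool.encode (NegCNF.decList decodeNat (boolUnpair c).1.length (boolUnpair c).2)) =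
      pairE strE (listE natE) (x, NegCNF.decList decodeNat (boolUnpair c).1.length (boolUnpair c).2) from rfl, hgspec]
    simp [bitE]
  have hdecode : ∀ p : List ℕ, NegCNF.decList decodeNat (boolUnpair (encodingNatBool.listBool.encode p)).1.length
      (boolUnpair (encodingNatBool.listBool.encode p)).2 = p := fun p => by
    have h := (hcan (encodingNatBool.listBool.encode p)).1
    rw [encodingNatBool.listBool.decode_encode] at h
    exact (Option.some.inj h).symm
  have hunary : ∀ t : ℕ, unaryEncodeNat t = List.replicate t true := fun t => (unE_eq_ones t).trans rfl
  refine ⟨V, hVP, 8 * X ^ 2 + 8, fun x => ?_⟩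
  constructor
  · rintro ⟨l, t, rfl, π, hinv, hfpf, hlet, hineq⟩
    obtain ⟨hplen, hplt, hpnd, hp⟩ := bavardGap_list_of_perm π
    set p := List.ofFn fun j : Fin l.length => ((π j : Fin l.length) : ℕ) with hpdef
    have hWlen : (l.flatMap fun a => [decide (a.1 = 1), a.2]).length = 2 * l.length := bavardGap_length_flatMap l
    have hn : (l.flatMap fun a => [decide (a.1 = 1), a.2]).length / 2 = l.length := by rw [hWlen]; omega
    refine ⟨encodingNatBool.listBool.encode p, ?_, ?_⟩
    · -- the certificate is short
      have hraw : ∀ q : List ℕ, (∀ a ∈ q, a < l.length) → (rawE natE q).length ≤ q.length * (2 * l.length + 2) := by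
        intro q hq
        induction q with
        | nil => simp
        | cons a q ih =>
          rw [rawE_cons, length_boolPair, List.length_cons]
          have ha : (natE a).length ≤ l.length := (length_natE_le a).trans (hq a (List.mem_cons_self ..)).le
          have := ih fun b hb => hq b (List.mem_cons_of_mem _ hb)
          nlinarith
      have h1 := hraw p hplt
      rw [hplen] at h1
      have h2 : (encodingNatBool.listBool.encode p).length ≤ 2 * l.length ^ 2 + 4 * l.length + 2 := by
        rw [listE_eq, show listE encodingNatBool.encode p = boolPair (unE p.length) (rawE natE p) from rfl, length_boolPair,
          show (unE p.length).length = p.length from unary_decode_encode_nat _, hplen]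
        nlinarith
      have h3 : l.length ≤ (boolPair (l.flatMap fun a => [decide (a.1 = 1), a.2]) (unaryEncodeNat t)).length := by
        rw [length_boolPair, hWlen]; omega
      have h4 : l.length ^ 2 ≤ (boolPair (l.flatMap fun a => [decide (a.1 = 1), a.2]) (unaryEncodeNat t)).length ^ 2 := Nat.pow_le_pow_left h3 2
      have h5 : l.length ≤ (boolPair (l.flatMap fun a => [decide (a.1 = 1), a.2]) (unaryEncodeNat t)).length ^ 2 :=
        h3.trans (Nat.le_self_pow two_ne_zero _)
      simp only [eval_add, eval_mul, eval_pow, eval_X, eval_ofNat]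
      nlinarith
    · rw [hVsem, hdecode, hspec]
      have htlen : (unaryEncodeNat t).length = t := by rw [hunary, List.length_replicate]
      simp only [fstF_boolPair, sndF_boolPair, hn, htlen]
      refine ⟨by simp, by simp [hWlen], by simp [hunary], hplen, hplt, hpnd, fun i hi => ?_, ?_⟩
      · have hpi : p.getD i 0 = ((π ⟨i, hi⟩ : Fin l.length) : ℕ) := hp ⟨i, hi⟩
        refine ⟨?_, ?_, ((bavardGap_letters_iff l π p hp hfpf).1 hlet i hi)⟩
        · rw [hpi, hp (π ⟨i, hi⟩), hinv]
        · rw [hpi]; exact fun h => hfpf ⟨i, hi⟩ (Fin.ext h)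
      · rw [bavardGap_filter_length_eq π p hp]
        exact hineq
  · rintro ⟨c, -, hc⟩
    rw [hVsem, hspec] at hc
    obtain ⟨hwp, heven, hones, hplen, hplt, hpnd, hper, hineq⟩ := hc
    set p := NegCNF.decList decodeNat (boolUnpair c).1.length (boolUnpair c).2 with hpdef
    set W := fstF x with hWdef
    set U := sndF x with hUdef
    set n := W.length / 2 with hndef
    set l : List (Fin 2 × Bool) := List.ofFn fun j : Fin n => ((if W.getD (2 * (j : ℕ)) false then (1 : Fin 2) else 0), W.getD (2 * (j : ℕ) + 1) false)
      with hldef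
    have hl : l.length = n := List.length_ofFn
    have hWl : (l.flatMap fun a => [decide (a.1 = 1), a.2]) = W := bavardGap_flatMap_lettersOf W heven
    have hx : x = boolPair (l.flatMap fun a => [decide (a.1 = 1), a.2]) (unaryEncodeNat U.length) := by
      rw [hWl, hunary, ← hones]; exact hwp.symm
    rw [← hl] at hplen hplt hper hineq
    rw [← hWl] at hper
    obtain ⟨π, hp⟩ := bavardGap_exists_perm_of_list p hplen hplt hpnd
    have hfpf : ∀ i, π i ≠ i := fun i h => (hper i i.isLt).2.1 (by rw [hp i, h])
    have hinv : ∀ i, π (π i) = i := fun i => Fin.ext (by rw [← hp (π i), ← hp i]; exact (hper i i.isLt).1)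
    refine ⟨l, U.length, hx, π, hinv, hfpf, (bavardGap_letters_iff l π p hp hfpf).2 fun i hi => (hper i hi).2.2, ?_⟩
    rw [← bavardGap_filter_length_eq π p hp]
    exact hineq

end Summit.PneNP.PneNP.Theorems
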